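import Literature.NumberTheory.NumberFields.AdicCompletionResidueHom
import Literature.NumberTheory.NumberFields.SelmerGroupOddClass
import HarnessLib

/-!
# Congruences modulo `v^N` from square classes in `K_v`: density of `𝓞 K` in `O_v` to any depth, and the
# dyadic criterion for `[d]_v ∈ (1 + 8 O_v) K_vˣ²`

Topic `NumberTheory/NumberFields`, namespace `Literature.NumberTheory.NumberFields`. Sequel of
`AdicCompletionResidueHom.lean` (depth one). At a finite place `v` of a number field `K` with a GLOBAL uniformiser
`ϖ ∈ 𝓞 K` (`ord_v ϖ = 1`), `𝓞 K` is dense in `O_v` to every depth (Neukirch II.4.3: `𝓞/v^N = O_v/𝔪_v^N`):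

* `exists_eq_add_pow_mul` — **every `z ∈ O_v` is `a + ϖ^N z'`** with `a ∈ 𝓞 K`, `z' ∈ O_v` (induction from the
  tree's depth-one density `exists_sub_algebraMap_mem_maximalIdeal` and `𝔪_v = ϖ O_v`).

At a place `v ∣ 2` with `ord_v 2 = 1` this turns the dyadic local condition of a `2`-isogeny descent — "`d t² ∈ 1 + 8 O_v`"
(tree `WeierstrassCurve.xSqClass_eq_sqClass_one_add_eight_mul`) — into a congruence and then into arithmetic in `ℤ/2^N`:

* `exists_sq_congr_of_mul_sq_eq_one_add` — **`d t² = 1 + 8m` (`d ∈ 𝓞 K`, `t ∈ K_vˣ`, `m ∈ O_v`) gives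
  `d a² ≡ 4^j (1 + 8b) (mod v^N)`** with `a ∈ 𝓞 K ∖ v`, `b ∈ 𝓞 K`, `2j = ord_v d`;
* `val_mod_eq_of_sq_congr` — **read through a residue map `ψ : 𝓞 K → ℤ/2^N` with kernel `⊇ v^N` and `ψ(a)` odd
  for `a ∉ v`: `ψ(d) mod 2^{min(2j+3, N)} = 4^j`** (odd squares are `≡ 1 mod 8`).

So a class `[d]` is killed at such a dyadic place as soon as `ψ(d)` is not of the form `4^j · (1 mod 8)` — the
familiar "`d ≡ 1 (mod 8)` up to the even part" test of `2`-descents over `ℚ` (Silverman *AEC* X.4.10), over a number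
field at a prime of degree one. Theorems only; no named facts.

## References
* [Neukirch1999] J. Neukirch, *Algebraic Number Theory* (1999), Ch. II Prop. 4.3 (`O/𝔭ⁿ ≅ Ô/𝔭̂ⁿ`).
* [SilvermanAEC2009] J. H. Silverman, *The Arithmetic of Elliptic Curves*, 2nd ed. (2009), Example X.4.10
  (dyadic local conditions `≡ 1 mod 8`).
-/

noncomputable section

open IsLocalRing IsDedekindDomain NumberField

namespace Literature.NumberTheory.NumberFields

variable {K : Type*} [Field K] [NumberField K] (v : HeightOneSpectrum (𝓞 K))

/-- Discreteness of `ℤᵐ⁰`: `x < 1` implies `x ≤ exp(-1)`. [folklore] -/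
private theorem le_exp_neg_one_of_lt_one {x : WithZero (Multiplicative ℤ)} (hx : x < 1) : x ≤ WithZero.exp (-1) := by
  by_cases h0 : x = 0
  · rw [h0]; exact zero_le
  · have h1 : WithZero.log x < 0 := (WithZero.log_lt_iff_lt_exp h0).mpr (by rwa [WithZero.exp_zero])
    exact (WithZero.log_le_iff_le_exp h0).mp (by omega)

/-- `z ∈ 𝔪_v ↔ v(z) < 1`. [folklore] -/
private theorem mem_maximalIdeal_iff_lt (z : v.adicCompletionIntegers K) :
    z ∈ maximalIdeal (v.adicCompletionIntegers K) ↔ Valued.v (z : v.adicCompletion K) < 1 := by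
  rw [mem_maximalIdeal, mem_nonunits_iff, HeightOneSpectrum.adicCompletionIntegers.isUnit_iff_valued_eq_one]
  have hle : Valued.v (z : v.adicCompletion K) ≤ 1 := (HeightOneSpectrum.mem_adicCompletionIntegers _ K v).mp z.2
  exact ⟨fun h => lt_of_le_of_ne hle h, fun h => h.ne⟩

/-! ## §1 Density of `𝓞 K` in `O_v` to depth `N` -/

/-- **`𝓞 K` is dense in `O_v` to every depth**: if `ϖ ∈ 𝓞 K` has `v(ϖ) = exp(-1)` then every `z ∈ O_v` is
`a + ϖ^N z'` with `a ∈ 𝓞 K`, `z' ∈ O_v` (Neukirch II.4.3). [cite: Neukirch1999, Ch. II Prop. 4.3] -/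
theorem exists_eq_add_pow_mul (ϖ : 𝓞 K) (hϖ : v.valuation K (ϖ : K) = WithZero.exp (-1)) (N : ℕ)
    (z : v.adicCompletionIntegers K) :
    ∃ a : 𝓞 K, ∃ z' : v.adicCompletionIntegers K,
      z = algebraMap (𝓞 K) (v.adicCompletionIntegers K) a + (algebraMap (𝓞 K) (v.adicCompletionIntegers K) ϖ) ^ N * z' := by
  have hval : ∀ x : K, Valued.v (algebraMap K (v.adicCompletion K) x) = v.valuation K x := fun x =>
    HeightOneSpectrum.valuedAdicCompletion_eq_valuation' v x
  have hϖL : Valued.v ((algebraMap (𝓞 K) (v.adicCompletionIntegers K) ϖ : v.adicCompletionIntegers K) :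
      v.adicCompletion K) = WithZero.exp (-1) := by
    rw [coe_algebraMap_adicCompletionIntegers_eq, hval]; exact hϖ
  have hϖ0 : ((algebraMap (𝓞 K) (v.adicCompletionIntegers K) ϖ : v.adicCompletionIntegers K) :
      v.adicCompletion K) ≠ 0 := by
    intro h; rw [h, map_zero] at hϖL; exact WithZero.coe_ne_zero hϖL.symm
  induction N with
  | zero => exact ⟨0, z, by rw [map_zero, pow_zero, one_mul, zero_add]⟩
  | succ N ih =>
    obtain ⟨a, z', hz⟩ := ih
    obtain ⟨c, hc⟩ := HeightOneSpectrum.exists_sub_algebraMap_mem_maximalIdeal K v z'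
    have hlt := (mem_maximalIdeal_iff_lt v _).mp hc
    -- `z' - c = ϖ m'` with `m' ∈ O_v`
    have hm' : ((z' - algebraMap (𝓞 K) (v.adicCompletionIntegers K) c : v.adicCompletionIntegers K) :
        v.adicCompletion K) / ((algebraMap (𝓞 K) (v.adicCompletionIntegers K) ϖ : v.adicCompletionIntegers K) :
          v.adicCompletion K) ∈ v.adicCompletionIntegers K := by
      rw [HeightOneSpectrum.mem_adicCompletionIntegers, map_div₀, hϖL]
      exact div_le_one_of_le₀ (le_exp_neg_one_of_lt_one hlt) zero_le
    refine ⟨a + ϖ ^ N * c, ⟨_, hm'⟩, ?_⟩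
    apply Subtype.ext
    have hz' := congrArg (fun t : v.adicCompletionIntegers K => (t : v.adicCompletion K)) hz
    push_cast at hz' ⊢
    rw [hz']
    field_simp
    ring

/-! ## §2 The square relation `d t² = 1 + 8 m` as a congruence modulo `v^N` -/

/-- **`d t² = 1 + 8m` in `K_v` gives `d a² ≡ 4^j (1 + 8 b) (mod v^N)` in `𝓞 K`.** At a place `v` with
`v(2) = exp(-1)` (degree one over `2`, unramified): for `d ∈ 𝓞 K`, `t ∈ K_vˣ`, `m ∈ O_v` with `d t² = 1 + 8m` there are
`j ≥ 0` (`2j = ord_v d`), `a ∈ 𝓞 K ∖ v`, `b ∈ 𝓞 K` with `d a² - 4^j (1 + 8 b) ∈ v^N` (`u = 2^j t` is a unit,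
`d u² = 4^j (1 + 8m)`; approximate `u ≡ a`, `m ≡ b` modulo `2^N O_v`). [cite: Neukirch1999, Ch. II Prop. 4.3] -/
theorem exists_sq_congr_of_mul_sq_eq_one_add (h2 : v.valuation K (2 : K) = WithZero.exp (-1)) {N : ℕ} (hN : 1 ≤ N)
    (d : 𝓞 K) {t m : v.adicCompletion K} (ht : t ≠ 0) (hm : Valued.v m ≤ 1)
    (h : algebraMap K (v.adicCompletion K) (d : K) * t ^ 2 = 1 + 8 * m) :
    ∃ (j : ℕ) (a b : 𝓞 K), a ∉ v.asIdeal ∧ d * a ^ 2 - 4 ^ j * (1 + 8 * b) ∈ v.asIdeal ^ N := by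
  have hval : ∀ x : K, Valued.v (algebraMap K (v.adicCompletion K) x) = v.valuation K x := fun x =>
    HeightOneSpectrum.valuedAdicCompletion_eq_valuation' v x
  have hv2 : Valued.v (2 : v.adicCompletion K) = WithZero.exp (-1) := by
    rw [← map_ofNat (algebraMap K (v.adicCompletion K)) 2, hval]; exact h2
  have h20 : (2 : v.adicCompletion K) ≠ 0 := fun h0 => by
    rw [h0, map_zero] at hv2; exact WithZero.coe_ne_zero hv2.symm
  have h8 : Valued.v (1 + 8 * m) = 1 := by
    rw [Valuation.map_add_eq_of_lt_left _ ?_, map_one]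
    rw [map_one, map_mul, show (8 : v.adicCompletion K) = 2 ^ 3 by norm_num, map_pow, hv2, ← WithZero.exp_nsmul]
    calc WithZero.exp ((3 : ℕ) • (-1 : ℤ)) * Valued.v m ≤ WithZero.exp ((3 : ℕ) • (-1 : ℤ)) * 1 := by gcongr
      _ < 1 := by rw [mul_one, ← WithZero.exp_zero, WithZero.exp_lt_exp]; simp only [nsmul_eq_mul]; norm_num
  -- `ord_v d = 2j`, `u = 2^j t` is a unit
  have hvt0 : Valued.v t ≠ 0 := (Valuation.ne_zero_iff _).mpr ht
  set n : ℤ := WithZero.log (Valued.v t) with hn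
  have hvt : Valued.v t = WithZero.exp n := by rw [hn, WithZero.exp_log hvt0]
  have hvd : Valued.v (algebraMap K (v.adicCompletion K) (d : K)) = WithZero.exp (-(2 * n)) := by
    have hprod : Valued.v (algebraMap K (v.adicCompletion K) (d : K)) * Valued.v t ^ 2 = 1 := by
      rw [← map_pow, ← map_mul, h, h8]
    have hd0 : Valued.v (algebraMap K (v.adicCompletion K) (d : K)) ≠ 0 := by
      intro h0; rw [h0, zero_mul] at hprod; exact zero_ne_one hprod
    have hlog := congrArg WithZero.log hprod
    rw [WithZero.log_mul hd0 (pow_ne_zero _ hvt0), WithZero.log_pow, WithZero.log_one, ← hn] at hlog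
    rw [← WithZero.exp_log hd0]
    congr 1
    simp only [nsmul_eq_mul, Nat.cast_ofNat] at hlog
    omega
  have hn0 : 0 ≤ n := by
    have hle : Valued.v (algebraMap K (v.adicCompletion K) (d : K)) ≤ 1 := by
      rw [hval]; exact HeightOneSpectrum.valuation_le_one v d
    rw [hvd, ← WithZero.exp_zero, WithZero.exp_le_exp] at hle
    omega
  obtain ⟨j, hj⟩ : ∃ j : ℕ, (j : ℤ) = n := ⟨n.toNat, Int.toNat_of_nonneg hn0⟩
  set u : v.adicCompletion K := t * 2 ^ j with hu
  have hvu : Valued.v u = 1 := by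
    rw [hu, map_mul, map_pow, hvt, hv2, ← WithZero.exp_nsmul, ← WithZero.exp_add, ← WithZero.exp_zero]
    congr 1; simp only [nsmul_eq_mul]; omega
  have hdu : algebraMap K (v.adicCompletion K) (d : K) * u ^ 2 = 4 ^ j * (1 + 8 * m) := by
    rw [hu, mul_pow, ← pow_mul, show (4 : v.adicCompletion K) = 2 ^ 2 by norm_num, ← pow_mul, ← h]; ring
  -- approximate `u` and `m` modulo `2^N O_v`
  have h2O : v.valuation K ((2 : 𝓞 K) : K) = WithZero.exp (-1) := by rw [show ((2 : 𝓞 K) : K) = 2 from rfl]; exact h2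
  have huO : u ∈ v.adicCompletionIntegers K := by rw [HeightOneSpectrum.mem_adicCompletionIntegers]; exact hvu.le
  have hmO : m ∈ v.adicCompletionIntegers K := by rw [HeightOneSpectrum.mem_adicCompletionIntegers]; exact hm
  obtain ⟨a, u', hua⟩ := exists_eq_add_pow_mul v 2 h2O N ⟨u, huO⟩
  obtain ⟨b, m', hmb⟩ := exists_eq_add_pow_mul v 2 h2O N ⟨m, hmO⟩
  have hua' := congrArg (fun z : v.adicCompletionIntegers K => (z : v.adicCompletion K)) hua
  have hmb' := congrArg (fun z : v.adicCompletionIntegers K => (z : v.adicCompletion K)) hmb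
  push_cast at hua' hmb'
  simp only [coe_algebraMap_adicCompletionIntegers_eq, map_ofNat] at hua' hmb'
  change u = algebraMap K _ (a : K) + (2 : v.adicCompletion K) ^ N * (u' : v.adicCompletion K) at hua'
  change m = algebraMap K _ (b : K) + (2 : v.adicCompletion K) ^ N * (m' : v.adicCompletion K) at hmb'
  refine ⟨j, a, b, ?_, ?_⟩
  · -- `a ∉ v`: `v(a) = v(u - 2^N u') = 1`
    intro ha
    have hva : Valued.v (algebraMap K (v.adicCompletion K) (a : K)) < 1 := by
      rw [hval]; exact (HeightOneSpectrum.valuation_lt_one_iff_mem _ _).mpr ha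
    have hsmall : Valued.v ((2 : v.adicCompletion K) ^ N * (u' : v.adicCompletion K)) < 1 := by
      rw [map_mul, map_pow, hv2, ← WithZero.exp_nsmul]
      have hu'le : Valued.v (u' : v.adicCompletion K) ≤ 1 :=
        (HeightOneSpectrum.mem_adicCompletionIntegers _ K v).mp u'.2
      calc WithZero.exp (N • (-1 : ℤ)) * Valued.v (u' : v.adicCompletion K) ≤ WithZero.exp (N • (-1 : ℤ)) * 1 := by
            gcongr
        _ < 1 := by rw [mul_one, ← WithZero.exp_zero, WithZero.exp_lt_exp]; simp only [nsmul_eq_mul]; omega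
    have := lt_of_le_of_lt (Valuation.map_add _ _ _) (max_lt hva hsmall)
    rw [← hua', hvu] at this
    exact lt_irrefl _ this
  · -- `d a² - 4^j (1 + 8 b) = 2^N · w` with `w ∈ O_v`
    set x : 𝓞 K := d * a ^ 2 - 4 ^ j * (1 + 8 * b) with hx
    by_cases hx0 : x = 0
    · rw [hx0]; exact zero_mem _
    rw [mem_pow_iff_log_valuation_le v hx0 N]
    have hxL : algebraMap K (v.adicCompletion K) (x : K) = (2 : v.adicCompletion K) ^ N *
        (-(2 * algebraMap K (v.adicCompletion K) (d : K) * u * u') +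
          (2 : v.adicCompletion K) ^ N * algebraMap K (v.adicCompletion K) (d : K) * u' ^ 2 + 8 * 4 ^ j * m') := by
      set g : 𝓞 K →+* v.adicCompletion K := (algebraMap K (v.adicCompletion K)).comp (algebraMap (𝓞 K) K) with hg
      have hgy : ∀ y : 𝓞 K, algebraMap K (v.adicCompletion K) (y : K) = g y := fun y => rfl
      have ea : g a = u - (2 : v.adicCompletion K) ^ N * u' := by rw [← hgy, hua']; ring
      have eb : g b = m - (2 : v.adicCompletion K) ^ N * m' := by rw [← hgy, hmb']; ring
      rw [hgy] at hdu ⊢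
      rw [hx, map_sub, map_mul, map_mul, map_pow, map_pow, map_add, map_mul, map_one, map_ofNat, map_ofNat, ea, eb]
      linear_combination hdu
    have hle : Valued.v (algebraMap K (v.adicCompletion K) (x : K)) ≤ WithZero.exp (-(N : ℤ)) := by
      rw [hxL, map_mul, map_pow, hv2, ← WithZero.exp_nsmul]
      have hint : Valued.v (-(2 * algebraMap K (v.adicCompletion K) (d : K) * u * u') +
          (2 : v.adicCompletion K) ^ N * algebraMap K (v.adicCompletion K) (d : K) * u' ^ 2 + 8 * 4 ^ j * m') ≤ 1 := by
        have hdle : Valued.v (algebraMap K (v.adicCompletion K) (d : K)) ≤ 1 := by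
          rw [hval]; exact HeightOneSpectrum.valuation_le_one v d
        have h2le : Valued.v (2 : v.adicCompletion K) ≤ 1 := by rw [hv2, ← WithZero.exp_zero, WithZero.exp_le_exp]; omega
        have hu'le : Valued.v (u' : v.adicCompletion K) ≤ 1 :=
          (HeightOneSpectrum.mem_adicCompletionIntegers _ K v).mp u'.2
        have hm'le : Valued.v (m' : v.adicCompletion K) ≤ 1 :=
          (HeightOneSpectrum.mem_adicCompletionIntegers _ K v).mp m'.2
        have h8le : Valued.v (8 : v.adicCompletion K) ≤ 1 := by
          rw [show (8 : v.adicCompletion K) = 2 ^ 3 by norm_num, map_pow]; exact pow_le_one₀ zero_le h2le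
        have h4le : Valued.v ((4 : v.adicCompletion K) ^ j) ≤ 1 := by
          rw [show (4 : v.adicCompletion K) = 2 ^ 2 by norm_num, ← pow_mul, map_pow]; exact pow_le_one₀ zero_le h2le
        refine le_trans (Valuation.map_add _ _ _) (max_le (le_trans (Valuation.map_add _ _ _) (max_le ?_ ?_)) ?_)
        · rw [Valuation.map_neg, map_mul, map_mul, map_mul, hvu, mul_one]
          exact mul_le_one' (mul_le_one' h2le hdle) hu'le
        · rw [map_mul, map_mul, map_pow, map_pow]
          exact mul_le_one' (mul_le_one' (pow_le_one₀ zero_le h2le) hdle) (pow_le_one₀ zero_le hu'le)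
        · rw [map_mul, map_mul]
          exact mul_le_one' (mul_le_one' h8le h4le) hm'le
      calc WithZero.exp (N • (-1 : ℤ)) * _ ≤ WithZero.exp (N • (-1 : ℤ)) * 1 := by gcongr
        _ = WithZero.exp (-(N : ℤ)) := by rw [mul_one]; simp only [nsmul_eq_mul, mul_neg, mul_one]
    have hx0' : Valued.v (algebraMap K (v.adicCompletion K) (x : K)) ≠ 0 := by
      rw [hval]; exact (Valuation.ne_zero_iff _).mpr (by exact_mod_cast hx0)
    rw [← hval, WithZero.log_le_iff_le_exp hx0']
    exact hle

/-! ## §3 Reading the congruence in `ℤ/2^N` -/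

/-- Odd squares are `1 (mod 8)`, in `ℤ/2^M`: if `w.val` is odd then `w² = 1 + 8e`. [folklore] -/
private theorem exists_sq_eq_one_add_eight {M : ℕ} {w : ZMod (2 ^ M)} (hw : w.val % 2 = 1) :
    ∃ e : ℕ, w ^ 2 = 1 + 8 * (e : ZMod (2 ^ M)) := by
  haveI : NeZero (2 ^ M) := ⟨pow_ne_zero M two_ne_zero⟩
  obtain ⟨k, hk⟩ : ∃ k, w.val = 2 * k + 1 := ⟨w.val / 2, by omega⟩
  obtain ⟨e, he⟩ := Nat.even_mul_succ_self k
  refine ⟨e, ?_⟩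
  have hw' : w = ((2 * k + 1 : ℕ) : ZMod (2 ^ M)) := by rw [← hk, ZMod.natCast_zmod_val]
  have hid : ((2 * k + 1 : ℕ) : ZMod (2 ^ M)) ^ 2 = 1 + 8 * (e : ZMod (2 ^ M)) := by
    have h' : (2 * k + 1) ^ 2 = 1 + 8 * e := by nlinarith [he]
    exact_mod_cast congrArg (fun n : ℕ => (n : ZMod (2 ^ M))) h'
  rw [hw']; exact hid

omit [NumberField K] in
/-- **The dyadic criterion.** Let `ψ : 𝓞 K → ℤ/2^N` kill `v^N` and send elements outside `v` to odd residues
(`N ≥ 1`). If `d a² - 4^j (1 + 8b) ∈ v^N` with `a ∉ v`, then `ψ(d) ≡ 4^j (mod 2^{min(2j+3, N)})`: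
in `ℤ/2^M`, `M = min(2j+3, N)`, one has `ψ(d) w² = 4^j` with `w` odd, `w² = 1 + 8e`, and `8 ψ(d) = 0`.
[cite: SilvermanAEC2009, Example X.4.10] -/
theorem val_mod_eq_of_sq_congr {N : ℕ} (hN : 1 ≤ N) (ψ : 𝓞 K →+* ZMod (2 ^ N))
    (hker : ∀ x : 𝓞 K, x ∈ v.asIdeal ^ N → ψ x = 0) (hodd : ∀ a : 𝓞 K, a ∉ v.asIdeal → (ψ a).val % 2 = 1)
    {d a b : 𝓞 K} {j : ℕ} (ha : a ∉ v.asIdeal) (hx : d * a ^ 2 - 4 ^ j * (1 + 8 * b) ∈ v.asIdeal ^ N) :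
    (ψ d).val % 2 ^ min (2 * j + 3) N = 4 ^ j % 2 ^ min (2 * j + 3) N := by
  haveI : NeZero (2 ^ N) := ⟨pow_ne_zero N two_ne_zero⟩
  set M := min (2 * j + 3) N with hM
  haveI : NeZero (2 ^ M) := ⟨pow_ne_zero M two_ne_zero⟩
  have hMN : M ≤ N := min_le_right _ _
  have hM3 : M ≤ 2 * j + 3 := min_le_left _ _
  have hM1 : 1 ≤ M := le_min (by omega) hN
  -- the relation in `ℤ/2^N`
  have hrel : ψ d * ψ a ^ 2 = 4 ^ j * (1 + 8 * ψ b) := by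
    have h0 := hker _ hx
    rw [map_sub, sub_eq_zero, map_mul, map_pow, map_mul, map_pow, map_add, map_mul, map_one] at h0
    simpa only [map_ofNat] using h0
  -- cast to `ℤ/2^M`
  let π : ZMod (2 ^ N) →+* ZMod (2 ^ M) := ZMod.castHom (pow_dvd_pow 2 hMN) (ZMod (2 ^ M))
  have hπval : ∀ z : ZMod (2 ^ N), (π z).val = z.val % 2 ^ M := fun z => by
    change (ZMod.cast z : ZMod (2 ^ M)).val = _
    rw [ZMod.cast_eq_val, ZMod.val_natCast]
  have h2M : (2 : ZMod (2 ^ M)) ^ (2 * j + 3) = 0 := by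
    obtain ⟨r, hr⟩ := Nat.exists_eq_add_of_le hM3
    rw [hr, pow_add]
    have : (2 : ZMod (2 ^ M)) ^ M = 0 := by exact_mod_cast ZMod.natCast_self (2 ^ M)
    rw [this, zero_mul]
  have hrelM : π (ψ d) * π (ψ a) ^ 2 = 4 ^ j := by
    have h1 := congrArg π hrel
    rw [map_mul, map_pow, map_mul, map_pow, map_add, map_mul, map_one] at h1
    simp only [map_ofNat] at h1
    rw [h1, mul_add, mul_one, show (4 : ZMod (2 ^ M)) ^ j * (8 * π (ψ b)) = 2 ^ (2 * j + 3) * π (ψ b) by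
      rw [pow_add, pow_mul]; norm_num; ring, h2M, zero_mul, add_zero]
  -- `π ψ a` is odd, so its square is `1 + 8e`
  have hwodd : (π (ψ a)).val % 2 = 1 := by
    rw [hπval, Nat.mod_mod_of_dvd _ (dvd_pow_self 2 (by omega))]; exact hodd a ha
  obtain ⟨e, he⟩ := exists_sq_eq_one_add_eight hwodd
  rw [he] at hrelM
  -- `8 x = 0`, hence `x = 4^j`
  set x := π (ψ d) with hxdef
  have hU : IsUnit ((1 + 8 * e : ℕ) : ZMod (2 ^ M)) := by
    rw [ZMod.isUnit_iff_coprime]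
    exact Nat.Coprime.pow_right M (Nat.coprime_two_right.mpr ⟨4 * e, by ring⟩)
  have h8x : 8 * x = 0 := by
    have h1 : 8 * x * ((1 + 8 * e : ℕ) : ZMod (2 ^ M)) = 0 := by
      push_cast
      rw [mul_assoc, hrelM, show (8 : ZMod (2 ^ M)) * 4 ^ j = 2 ^ (2 * j + 3) by rw [pow_add, pow_mul]; norm_num; ring,
        h2M]
    exact (hU.mul_left_eq_zero).mp h1
  have hxj : x = 4 ^ j := by
    rw [← hrelM, mul_add, mul_one, ← mul_assoc, mul_comm x 8, h8x, zero_mul, add_zero]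
  -- read off the values
  have hv1 : x.val = (ψ d).val % 2 ^ M := hπval _
  have hv2 : ((4 : ZMod (2 ^ M)) ^ j).val = 4 ^ j % 2 ^ M := by
    rw [show (4 : ZMod (2 ^ M)) ^ j = ((4 ^ j : ℕ) : ZMod (2 ^ M)) by push_cast; rfl, ZMod.val_natCast]
  rw [← hv1, hxj, hv2]

end Literature.NumberTheory.NumberFields

end
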